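import Literature.AnabelianGeometry.EtaleTheta.LogDivisorTower

/-!
# [EtTh] Def. 3.1 / Prop. 3.2 / Def. 3.3 (iii): RESTRICTING a log-divisor model, a Galois action and a log-divisor TOWER to a stable
# subgroup of functions (generic, class (b) constructions — every law restricts)

S. Mochizuki, *The étale theta function …*, Publ. RIMS **45** (2009) [MochizukiEtTh2009], Def. 3.1 (i)(ii) / Prop. 3.2 p.70, Def. 3.3
(iii) pp.73–74 [cite: MochizukiEtTh2009, Def 3.3 (iii) p.73].

GENERIC TOOL (abc-iut cell, layer L2; seat abc-iut-L2-t3 (gen 7); route (R2) of this seat's FINDING #4 «E2 obstruction of the sign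
passenger», STATUS 2026-08-27 ≈02:50Z): a sub-group of functions `S ≤ Fn(Z_∞)` — e.g. the functions of a Kummer level WITHOUT the
level-`0` sign coordinate — inherits the whole Def. 3.1 / Prop. 3.2 structure, a Galois action stabilising it, and, level-wise, a tower
whose transitions respect it:
* `LogDivisorModel.restrict Z S` — functions `S`, log-divisors / cusps / components UNCHANGED, `Mero`, `L^×`, `O_L^▷`, tempered-meromorphic
  = the traces on `S`, divisor = the restriction; Prop. 3.2 (i)–(iii) restrict (`(iii)`: roots in `S` are roots in `Fn`);
  `restrict_cuspLaws`;
* `GaloisAction.restrict A S hS` for `hS : ∀ g, ∀ f ∈ S, g·f ∈ S` (`subAut`: the induced automorphisms of `S`);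
* `LogDivisorTower.restrict T S hact hres` for a family `S i ≤ Fn(Z_∞^{(i)})` stable under every level action and mapped into itself
  by every transition — every tower law restricts (`act_closure_fn`: a trivial automorphism restricts to a trivial one).
Defs + theorems only; no Prop-valued fact, no instance, no notation, no sorry.  HONEST FRAMING: interface plumbing over OUR typed
records; nothing here bears on [IUTchIII] Cor. 3.12; no side taken; typed ≠ proved.
-/

noncomputable section

namespace Literature.AnabelianGeometry.EtaleTheta

open CategoryTheory Function

universe u

namespace LogDivisorModel

variable (Z : LogDivisorModel.{u}) (S : Subgroup Z.Fn)

/-- The inclusion of the log-meromorphic functions lying in `S` into the log-meromorphic functions. [cite: MochizukiEtTh2009, Def 3.1 p.70] -/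
def logMeroIncl : (Z.logMero.comap S.subtype) →* Z.logMero where
  toFun f := ⟨f.1.1, f.2⟩
  map_one' := rfl
  map_mul' _ _ := rfl

/-- **Restriction of a log-divisor model to a subgroup of functions** `S ≤ Fn(Z_∞)`: same log-divisors, cusps and components; the
function-side data are the traces on `S`. [cite: MochizukiEtTh2009, Def 3.1 p.70] -/
def restrict : LogDivisorModel.{u} where
  Fn := S
  DIV := Z.DIV
  DIVplus := Z.DIVplus
  Div := Z.Div
  exists_div_eq := Z.exists_div_eq
  eq_one_of_mem_of_inv_mem := Z.eq_one_of_mem_of_inv_mem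
  nonCuspidal := Z.nonCuspidal
  cuspidal := Z.cuspidal
  nonCuspidal_isCompl_cuspidal := Z.nonCuspidal_isCompl_cuspidal
  logMero := Z.logMero.comap S.subtype
  divisor := Z.divisor.comp (Z.logMeroIncl S)
  divisor_mem_Div f := Z.divisor_mem_Div _
  const := Z.const.comap S.subtype
  const_le_logMero := Subgroup.comap_mono Z.const_le_logMero
  intConst := Z.intConst.comap S.subtype
  intConst_le_const := fun _ hf => Z.intConst_le_const hf
  temperedMero := Z.temperedMero.comap S.subtype
  temperedMero_le_logMero := Subgroup.comap_mono Z.temperedMero_le_logMero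
  exists_pow_mem_Div := Z.exists_pow_mem_Div
  Cusp := Z.Cusp
  Comp := Z.Comp
  divPlusEquiv := Z.divPlusEquiv
  divPlusEquiv_nonCuspidal := Z.divPlusEquiv_nonCuspidal
  mem_intConst_of_divisor_mem f hf := Z.mem_intConst_of_divisor_mem ⟨f.1.1, f.2⟩ hf
  divisor_mem_of_mem_intConst f hf := Z.divisor_mem_of_mem_intConst ⟨f.1.1, f.2⟩ hf
  divisor_eq_one_iff f := Z.divisor_eq_one_iff ⟨f.1.1, f.2⟩
  eq_one_of_forall_exists_pow_eq f hf := Subtype.ext (Z.eq_one_of_forall_exists_pow_eq f.1 fun N => by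
    obtain ⟨g, hg⟩ := hf N
    exact ⟨g.1, by rw [← Subgroup.coe_pow, hg]⟩)

/-- The functions of the restricted model are `S`. [cite: MochizukiEtTh2009, Def 3.1 p.70] -/
theorem restrict_Fn : (Z.restrict S).Fn = S := rfl

/-- The log-divisors of the restricted model are those of `Z`. [cite: MochizukiEtTh2009, Def 3.1 p.70] -/
theorem restrict_DIV : (Z.restrict S).DIV = Z.DIV := rfl

/-- Membership in the constants of the restricted model. [cite: MochizukiEtTh2009, Def 3.1 p.70] -/
theorem mem_restrict_const_iff (f : S) : f ∈ (Z.restrict S).const ↔ (f : Z.Fn) ∈ Z.const := Iff.rfl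

/-- Membership in the integral constants of the restricted model. [cite: MochizukiEtTh2009, Def 3.1 p.70] -/
theorem mem_restrict_intConst_iff (f : S) : f ∈ (Z.restrict S).intConst ↔ (f : Z.Fn) ∈ Z.intConst := Iff.rfl

/-- Membership in the log-meromorphic functions of the restricted model. [cite: MochizukiEtTh2009, Def 3.1 p.70] -/
theorem mem_restrict_logMero_iff (f : S) : f ∈ (Z.restrict S).logMero ↔ (f : Z.Fn) ∈ Z.logMero := Iff.rfl

/-- The divisor of the restricted model is the divisor of `Z`. [cite: MochizukiEtTh2009, Def 3.1 p.70] -/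
theorem restrict_divisor_apply (f : (Z.restrict S).logMero) : (Z.restrict S).divisor f = Z.divisor ⟨f.1.1, f.2⟩ := rfl

/-- Multiplicities are unchanged. [cite: MochizukiEtTh2009, Def 3.1 p.70] -/
theorem restrict_mult (d : Z.DIVplus) (x : Z.Idx) : (Z.restrict S).mult d x = Z.mult d x := rfl

/-- The tacit cusp laws restrict (they concern log-divisors only). [cite: MochizukiEtTh2009, Def 3.1 p.70] -/
theorem restrict_cuspLaws (h : Z.CuspLaws) : (Z.restrict S).CuspLaws :=
  ⟨h.cuspidal_le_Div, h.mem_cuspidal_iff⟩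

/-! ## Restricting a Galois action -/

namespace GaloisAction

variable {Z} {G : Type u} [Group G] (A : Z.GaloisAction G) {S}
variable (hS : ∀ (g : G) (f : Z.Fn), f ∈ S → A.actFn g f ∈ S)

/-- The automorphism of `S` induced by `g` (for an `actFn`-stable `S`). [cite: MochizukiEtTh2009, Def 3.3 p.73] -/
def subAut (g : G) : S ≃* S where
  toFun f := ⟨A.actFn g f, hS g f f.2⟩
  invFun f := ⟨A.actFn g⁻¹ f, hS g⁻¹ f f.2⟩
  left_inv f := Subtype.ext (by change A.actFn g⁻¹ (A.actFn g f) = f; rw [← MulAut.mul_apply, ← map_mul, inv_mul_cancel, map_one]; rfl)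
  right_inv f := Subtype.ext (by change A.actFn g (A.actFn g⁻¹ f) = f; rw [← MulAut.mul_apply, ← map_mul, mul_inv_cancel, map_one]; rfl)
  map_mul' f f' := Subtype.ext (map_mul (A.actFn g) f.1 f'.1)

/-- `subAut g f = g · f`. [cite: MochizukiEtTh2009, Def 3.3 p.73] -/
@[simp] theorem coe_subAut (g : G) (f : S) : ((A.subAut hS g f : S) : Z.Fn) = A.actFn g f := rfl

/-- `g ↦ subAut g` is a homomorphism. [cite: MochizukiEtTh2009, Def 3.3 p.73] -/
def subActFn : G →* MulAut S where
  toFun := A.subAut hS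
  map_one' := MulEquiv.ext fun f => Subtype.ext (by rw [coe_subAut, map_one]; rfl)
  map_mul' g g' := MulEquiv.ext fun f => Subtype.ext (by rw [coe_subAut, map_mul]; rfl)

/-- `subActFn g f = g · f`. [cite: MochizukiEtTh2009, Def 3.3 p.73] -/
@[simp] theorem coe_subActFn (g : G) (f : S) : ((A.subActFn hS g f : S) : Z.Fn) = A.actFn g f := rfl

/-- **Restriction of a Galois action to a stable subgroup of functions** (log-divisors, cusps, components act as before; every law
restricts). [cite: MochizukiEtTh2009, Def 3.3 p.73] -/
def restrict : (Z.restrict S).GaloisAction G where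
  actFn := A.subActFn hS
  actDIV := A.actDIV
  permCusp := A.permCusp
  permComp := A.permComp
  act_mem_DIVplus := A.act_mem_DIVplus
  act_mem_Div := A.act_mem_Div
  act_mem_logMero g _ hf := A.act_mem_logMero g hf
  act_mem_const g _ hf := A.act_mem_const g hf
  act_mem_intConst g _ hf := A.act_mem_intConst g hf
  divisor_act g f := A.divisor_act g ⟨f.1.1, f.2⟩
  mult_act := A.mult_act

/-- The restricted action on functions is the induced one. [cite: MochizukiEtTh2009, Def 3.3 p.73] -/
theorem restrict_actFn (g : G) : (A.restrict hS).actFn g = A.subAut hS g := rfl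

/-- … on underlying functions: `g · f` computed in `Z`. [cite: MochizukiEtTh2009, Def 3.3 p.73] -/
theorem restrict_actFn_coe (g : G) (f : S) : ((A.restrict hS).actFn g f).1 = A.actFn g f := rfl

/-- The restricted action on log-divisors is unchanged. [cite: MochizukiEtTh2009, Def 3.3 p.73] -/
theorem restrict_actDIV : (A.restrict hS).actDIV = A.actDIV := rfl

/-- A trivially acting element acts trivially on the restriction. [cite: MochizukiEtTh2009, Def 3.3 (i) p.72] -/
theorem restrict_actFn_eq_one {g : G} (hg : A.actFn g = 1) : (A.restrict hS).actFn g = 1 :=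
  MulEquiv.ext fun f => Subtype.ext (show A.actFn g f.1 = f.1 by rw [hg]; rfl)

end GaloisAction

end LogDivisorModel

/-! ## Restricting a log-divisor tower level-wise -/

namespace LogDivisorTower

variable {P : Type u} [Group P] [TopologicalSpace P] {L : LevelSystem P} (T : LogDivisorTower P L)
  (S : ∀ i, Subgroup (T.Z i).Fn) (hact : ∀ (i) (g : P) (f : (T.Z i).Fn), f ∈ S i → (T.act i).actFn g f ∈ S i)
  (hres : ∀ {i j} (h : L.closure j ≤ L.closure i) (f : (T.Z i).Fn), f ∈ S i → T.resFn h f ∈ S j)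

/-- The transition on the sub-functions. [cite: MochizukiEtTh2009, Def 3.3 (iii) p.73] -/
def subResFn {i j : L.I} (h : L.closure j ≤ L.closure i) : S i →* S j where
  toFun f := ⟨T.resFn h f, hres h f f.2⟩
  map_one' := Subtype.ext (map_one (T.resFn h))
  map_mul' f f' := Subtype.ext (map_mul (T.resFn h) f.1 f'.1)

/-- `subResFn h f = resFn h f`. [cite: MochizukiEtTh2009, Def 3.3 (iii) p.73] -/
@[simp] theorem coe_subResFn {i j : L.I} (h : L.closure j ≤ L.closure i) (f : S i) :
    (T.subResFn S hres h f).1 = T.resFn h f.1 := rfl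

/-- **Restriction of a log-divisor tower to a stable family of subgroups of functions** `S i ≤ Fn(Z_∞^{(i)})` — stable under every
level action and mapped into itself by every transition; EVERY tower law restricts. [cite: MochizukiEtTh2009, Def 3.3 (iii) p.73] -/
def restrict : LogDivisorTower P L where
  Z i := (T.Z i).restrict (S i)
  cuspLaws i := (T.Z i).restrict_cuspLaws (S i) (T.cuspLaws i)
  act i := (T.act i).restrict (hact i)
  act_closure_fn i g hg := LogDivisorModel.GaloisAction.restrict_actFn_eq_one _ _ (T.act_closure_fn i g hg)
  act_closure_div i g hg := T.act_closure_div i g hg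
  resFn h := T.subResFn S hres h
  resDIV h := T.resDIV h
  resFn_refl i f := Subtype.ext (T.resFn_refl i f.1)
  resFn_trans hij hjk f := Subtype.ext (T.resFn_trans hij hjk f.1)
  resDIV_refl := T.resDIV_refl
  resDIV_trans := T.resDIV_trans
  resFn_injective h := fun _ _ hab => Subtype.ext (T.resFn_injective h (congrArg Subtype.val hab))
  resFn_mem_logMero h _ hf := T.resFn_mem_logMero h hf
  resFn_mem_const h _ hf := T.resFn_mem_const h hf
  resFn_mem_intConst h _ hf := T.resFn_mem_intConst h hf
  resDIV_mem_DIVplus := T.resDIV_mem_DIVplus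
  resDIV_mem_Div := T.resDIV_mem_Div
  resDIV_mem_nonCuspidal := T.resDIV_mem_nonCuspidal
  resDIV_mem_cuspidal := T.resDIV_mem_cuspidal
  divisor_resFn h f := T.divisor_resFn h ⟨f.1.1, f.2⟩
  resFn_act h g f := Subtype.ext (T.resFn_act h g f.1)
  resDIV_act := T.resDIV_act

/-- The levels of the restricted tower. [cite: MochizukiEtTh2009, Def 3.3 (iii) p.73] -/
theorem restrict_Z (i : L.I) : (T.restrict S hact hres).Z i = (T.Z i).restrict (S i) := rfl

/-- The level actions of the restricted tower. [cite: MochizukiEtTh2009, Def 3.3 (iii) p.73] -/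
theorem restrict_act (i : L.I) : (T.restrict S hact hres).act i = (T.act i).restrict (hact i) := rfl

/-- The transitions of the restricted tower on functions. [cite: MochizukiEtTh2009, Def 3.3 (iii) p.73] -/
theorem coe_restrict_resFn {i j : L.I} (h : L.closure j ≤ L.closure i) (f : ((T.restrict S hact hres).Z i).Fn) :
    ((T.restrict S hact hres).resFn h f).1 = T.resFn h f.1 := rfl

end LogDivisorTower

end Literature.AnabelianGeometry.EtaleTheta

end
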